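import Literature.GroupTheory.CombinatorialGroupTheory.CyclicBlockInterchangeNu
import Mathlib.Algebra.BigOperators.Fin
import HarnessLib

/-!
# The 3-PARTITION gadget of Heuer (2020), §4.1, for families of four

[Heuer2020, §4.1] reduces 3-PARTITION to CBI over `A = {a, b, c, d}`: for an instance
`a₁, …, a_{mn}`, `B` ("`B/(m+1) < aᵢ < B/(m−1)`, wlog `Σ aᵢ = nB`") the words
"`v = a^{n+1} Πᵢ b c^{aᵢ} d b`, `w = (a c^B d^m)^n a b^{mn+1}`" satisfy **Thm. 4.1**: the instance
is solvable iff `d_cbi(v, w) = mn`; Claim 4.2: always `≥ mn`; Claim 4.3: a solution gives `mn`;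
Claim 4.4: `mn` interchanges give a solution. Heuer takes `m = 3` (3-PARTITION,
[GareyJohnson1979, SP15]); this file takes **`m = 4`** (the "4-PARTITION" problem of
[GareyJohnson1979, Thm. 4.3], whose NP-hardness proof from 3DM is the direct one), for which the
argument is verbatim the same.

* `FPG.itemW`, `FPG.vWord`, `FPG.groupW`, `FPG.wWord`: the words;
* `FPG.nuL_vWord`, `FPG.nuL_wWord`: `ν(v) − ν(w) = 24 n` (Lemma 4.5 (i) with `6mn`, `m = 4`);
* `FPG.reach_of_solution` (Claim 4.3): a solution yields `4n` interchanges `v → w`;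
* `FPG.solution_of_reach` (Claims 4.2/4.4): `v ~ w` and `d_cbi(v,w) ≤ 4n` yield a solution — every
  interchange must lower `ν` by `6`, hence cuts no `cc` (`CyclicBlockInterchangeNu.lean`), so the
  runs `c^{aᵢ}` travel intact into the runs `c^B` of `w`, four to a run by counting;
* `FPG.solvable_iff`: the equivalence used by the Karp reduction (`FourPartitionCBI.lean`).

Everything here is proved; no named facts.

## References

* [Heuer2020] N. Heuer, *Computing commutator length is hard*, arXiv:2001.10230, §4.1.
* [GareyJohnson1979] M. R. Garey, D. S. Johnson, *Computers and Intractability*, 1979, §4.2,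
  Thm. 4.3 (4-PARTITION) and Thm. 4.4 (3-PARTITION).
-/

namespace Literature.GroupTheory.CombinatorialGroupTheory

namespace FPG

open Equiv Equiv.Perm CBI

/-! ### The words -/

/-- The item word `b c^x d`. [cite: Heuer2020, §4.1] -/
def itemW (x : ℕ) : List (Fin 4) := 1 :: (List.replicate x 2 ++ [3])

/-- `v = a^{n+1} (Πᵢ b c^{aᵢ} d) b`. [cite: Heuer2020, §4.1] -/
def vWord (A : List ℕ) (n : ℕ) : List (Fin 4) := List.replicate (n + 1) 0 ++ A.flatMap itemW ++ [1]

/-- The group word `a c^B d^4`. [cite: Heuer2020, §4.1] -/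
def groupW (B : ℕ) : List (Fin 4) := 0 :: (List.replicate B 2 ++ List.replicate 4 3)

/-- `w = (a c^B d^4)^n a b^{4n+1}`. [cite: Heuer2020, §4.1] -/
def wWord (n B : ℕ) : List (Fin 4) := (List.replicate n (groupW B)).flatten ++ [0] ++ List.replicate (4 * n + 1) 1

/-- Length of an item word. [folklore] -/
@[simp] theorem length_itemW (x : ℕ) : (itemW x).length = x + 2 := by simp [itemW]

/-- Length of a group word. [folklore] -/
@[simp] theorem length_groupW (B : ℕ) : (groupW B).length = B + 5 := by simp [groupW]

/-! ### `ν` of the two words (Lemma 4.5 (i)) -/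

/-- `lin` of a constant block. [folklore] -/
theorem lin_replicate (k : ℕ) (y : Fin 4) : lin (List.replicate (k + 1) y) = k * wt y y := by
  induction k with
  | zero => simp [lin]
  | succ k ih =>
    rw [List.replicate_succ, List.replicate_succ, lin_cons_cons, ← List.replicate_succ, ih]
    push_cast
    ring

/-- `lin` of an item word: `3 − x` (`x ≥ 1`). [cite: Heuer2020, Lemma 4.5 (i)] -/
theorem lin_itemW {x : ℕ} (hx : 1 ≤ x) : lin (itemW x) = 3 - x := by
  obtain ⟨k, rfl⟩ : ∃ k, x = k + 1 := ⟨x - 1, by omega⟩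
  have e : itemW (k + 1) = ([1] ++ List.replicate (k + 1) 2) ++ [3] := by simp [itemW]
  rw [e, lin_append (by simp) (by simp), lin_append (by simp) (by simp), lin_replicate]
  simp [lin, wt]
  omega

/-- `lin` of a group word: `−B − 2` (`B ≥ 1`). [cite: Heuer2020, Lemma 4.5 (i)] -/
theorem lin_groupW {B : ℕ} (hB : 1 ≤ B) : lin (groupW B) = -B - 2 := by
  obtain ⟨k, rfl⟩ : ∃ k, B = k + 1 := ⟨B - 1, by omega⟩
  have e : groupW (k + 1) = ([0] ++ List.replicate (k + 1) 2) ++ List.replicate (3 + 1) 3 := by simp [groupW]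
  rw [e, lin_append (by simp) (by simp), lin_append (by simp) (by simp), lin_replicate, lin_replicate]
  simp [lin, wt]
  omega

/-- `linJ` of a run of equal summaries. [folklore] -/
theorem linJ_replicate (k : ℕ) (q : Fin 4 × Fin 4) : linJ (List.replicate (k + 1) q) = k * wt q.2 q.1 := by
  induction k with
  | zero => simp [linJ]
  | succ k ih =>
    rw [List.replicate_succ, List.replicate_succ, linJ, ← List.replicate_succ, ih]
    push_cast
    ring

/-- The summary of an item word. [folklore] -/
theorem bsumD_itemW (x : ℕ) : bsumD (itemW x) = (1, 3) := by
  simp only [bsumD, itemW, List.headD_cons, Prod.mk.injEq, true_and]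
  rw [List.getLastD_eq_getLast?, List.getLast?_eq_some_getLast (List.cons_ne_nil _ _)]
  simp

/-- The summary of a group word. [folklore] -/
theorem bsumD_groupW (B : ℕ) : bsumD (groupW B) = (0, 3) := by
  simp only [bsumD, groupW, List.headD_cons, Prod.mk.injEq, true_and]
  rw [List.getLastD_eq_getLast?, List.getLast?_eq_some_getLast (List.cons_ne_nil _ _)]
  simp

/-- `lin` of the items part of `v`. [cite: Heuer2020, Lemma 4.5 (i)] -/
theorem lin_flatMap_itemW (A : List ℕ) (hA : A ≠ []) (h1 : ∀ x ∈ A, 1 ≤ x) :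
    lin (A.flatMap itemW) = 3 * A.length - (A.sum : ℤ) + (A.length - 1) := by
  rw [List.flatMap_def, lin_flatten _ (fun w hw => by
    obtain ⟨x, -, rfl⟩ := List.mem_map.1 hw; simp [itemW])]
  have hsum : ((A.map itemW).map lin).sum = 3 * A.length - (A.sum : ℤ) := by
    rw [List.map_map]
    have : ∀ A' : List ℕ, (∀ x ∈ A', 1 ≤ x) → (A'.map (lin ∘ itemW)).sum = 3 * A'.length - (A'.sum : ℤ) := by
      intro A' h1'
      induction A' with
      | nil => simp
      | cons x A' ih =>
        rw [List.map_cons, List.sum_cons, Function.comp_apply, lin_itemW (h1' x (by simp)),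
          ih (fun y hy => h1' y (List.mem_cons_of_mem _ hy))]
        simp only [List.length_cons, List.sum_cons]
        push_cast
        ring
    exact this A h1
  have hJ : linJ ((A.map itemW).map bsumD) = (A.length - 1 : ℤ) := by
    rw [List.map_map, show (A.map (bsumD ∘ itemW)) = List.replicate A.length ((1 : Fin 4), (3 : Fin 4)) from
      List.eq_replicate_iff.2 ⟨by simp, fun p hp => by
        obtain ⟨x, -, rfl⟩ := List.mem_map.1 hp; exact bsumD_itemW x⟩]
    obtain ⟨k, hk⟩ : ∃ k, A.length = k + 1 := Nat.exists_eq_add_one_of_ne_zero (by simpa using List.length_pos_iff.2 hA |>.ne')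
    rw [hk, linJ_replicate]
    simp [wt]
  rw [hsum, hJ]

/-- **`ν(v) = 17 n − Σ aᵢ`** for `|A| = 4n`, all `aᵢ ≥ 1`. [cite: Heuer2020, Lemma 4.5 (i)] -/
theorem nuL_vWord (A : List ℕ) (n : ℕ) (hA : A.length = 4 * n) (h1 : ∀ x ∈ A, 1 ≤ x) :
    nuL (vWord A n) = 17 * n - (A.sum : ℤ) := by
  rcases Nat.eq_zero_or_pos n with rfl | hn
  · obtain rfl : A = [] := List.length_eq_zero_iff.1 (by simpa using hA)
    decide
  have hA0 : A ≠ [] := by rintro rfl; simp at hA; omega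
  set I := A.flatMap itemW with hI
  have hI0 : I ≠ [] := by
    obtain ⟨x, A', rfl⟩ := List.exists_cons_of_ne_nil hA0
    simp [hI, itemW]
  have hIhead : I.head hI0 = 1 := by
    obtain ⟨x, A', hxA⟩ := List.exists_cons_of_ne_nil hA0
    simp [hI, hxA, itemW]
  have hIlast : I.getLast hI0 = 3 := by
    have hm : A.map itemW ≠ [] := by simpa using hA0
    have hml : (A.map itemW).getLast hm ≠ [] := by rw [List.getLast_map]; simp [itemW]
    change (A.map itemW).flatten.getLast (by simpa [hI, List.flatMap_def] using hI0) = 3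
    rw [List.getLast_flatten_eq_getLast_getLast _ hml]
    simp [List.getLast_map, itemW]
  have hR0 : List.replicate (n + 1) (0 : Fin 4) ≠ [] := by simp
  have hv0 : vWord A n ≠ [] := by simp [vWord]
  rw [nuL_eq_lin _ hv0]
  have hsplit : vWord A n = (List.replicate (n + 1) 0 ++ I) ++ [1] := rfl
  have hlin : lin (vWord A n) = n + lin I + 1 := by
    rw [hsplit, lin_append (by simp) (by simp), lin_append hR0 hI0, lin_replicate, hIhead,
      List.getLast_append_of_ne_nil _ hI0, hIlast, List.getLast_replicate]
    simp [lin, wt]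
  have hhead : (vWord A n).head hv0 = 0 := by simp [vWord, List.replicate_succ]
  have hlast : (vWord A n).getLast hv0 = 1 := by simp [vWord]
  rw [hlin, hhead, hlast, hI, lin_flatMap_itemW A hA0 h1, hA]
  simp [wt]
  ring

/-- **`ν(w) = −n B − 7 n`** (`n ≥ 1`, `B ≥ 1`). [cite: Heuer2020, Lemma 4.5 (i)] -/
theorem nuL_wWord {n B : ℕ} (hn : 1 ≤ n) (hB : 1 ≤ B) : nuL (wWord n B) = -(n * B : ℤ) - 7 * n := by
  obtain ⟨k, rfl⟩ : ∃ k, n = k + 1 := ⟨n - 1, by omega⟩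
  set G := (List.replicate (k + 1) (groupW B)).flatten with hG
  have hG0 : G ≠ [] := by simp [hG, groupW, List.replicate_succ]
  have hGhead : G.head hG0 = 0 := by simp [hG, groupW, List.replicate_succ]
  have hGlast : G.getLast hG0 = 3 := by
    have hm : List.replicate (k + 1) (groupW B) ≠ [] := by simp
    have hml : (List.replicate (k + 1) (groupW B)).getLast hm ≠ [] := by rw [List.getLast_replicate]; simp [groupW]
    change (List.replicate (k + 1) (groupW B)).flatten.getLast (by simpa [hG] using hG0) = 3
    rw [List.getLast_flatten_eq_getLast_getLast _ hml]
    simp [List.getLast_replicate, groupW]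
  have hlinG : lin G = (k + 1 : ℕ) * (-(B : ℤ) - 2) + k * wt 3 0 := by
    rw [hG, lin_flatten _ (fun w hw => by rw [List.eq_of_mem_replicate hw]; simp [groupW]), List.map_replicate,
      List.sum_replicate, List.map_replicate, bsumD_groupW, linJ_replicate, lin_groupW hB]
    simp
  have hw0 : wWord (k + 1) B ≠ [] := by simp [wWord]
  rw [nuL_eq_lin _ hw0]
  have hsplit : wWord (k + 1) B = (G ++ [0]) ++ List.replicate (4 * (k + 1) + 1) 1 := rfl
  have hlin : lin (wWord (k + 1) B) = lin G + wt 3 0 + (4 * (k + 1) : ℕ) * wt 1 1 + wt 0 1 := by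
    rw [hsplit, lin_append (by simp) (by simp), lin_append hG0 (by simp), hGlast, lin_replicate]
    simp only [lin, List.getLast_append_of_ne_nil _ (List.cons_ne_nil _ _), List.getLast_singleton,
      List.head_replicate, List.head_cons]
    ring
  have hhead : (wWord (k + 1) B).head hw0 = 0 := by simp [wWord, groupW, List.replicate_succ]
  have hlast : (wWord (k + 1) B).getLast hw0 = 1 := by simp [wWord]
  rw [hlin, hhead, hlast, hlinG]
  simp [wt]
  ring

/-- **Lemma 4.5 (i)** (`m = 4`): `ν(v) − ν(w) = 24 n` when `Σ aᵢ = n B`. [cite: Heuer2020, Lemma 4.5 (i)] -/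
theorem nuL_vWord_sub_nuL_wWord (A : List ℕ) (n B : ℕ) (hA : A.length = 4 * n) (h1 : ∀ x ∈ A, 1 ≤ x)
    (hB : ∀ x ∈ A, 3 * x < B) (hsum : A.sum = n * B) : nuL (vWord A n) - nuL (wWord n B) = 24 * n := by
  rcases Nat.eq_zero_or_pos n with rfl | hn
  · obtain rfl : A = [] := List.length_eq_zero_iff.1 (by simpa using hA)
    simp [vWord, wWord]
  have hA0 : A ≠ [] := by rintro rfl; simp at hA; omega
  obtain ⟨x, hx⟩ := List.exists_mem_of_ne_nil A hA0
  have hB1 : 1 ≤ B := by have := hB x hx; omega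
  rw [nuL_vWord A n hA h1, nuL_wWord hn hB1, hsum]
  push_cast
  ring

/-! ### Claim 4.3: a solution gives `4n` interchanges -/

section Construction

variable {N n : ℕ} (c : Fin N → ℕ) (g : Fin N → Fin n) (j : Fin n)

/-- Accumulated weight of the items `< t` assigned to group `j`. [folklore] -/
def acc (t : ℕ) : ℕ := ∑ i : Fin N, if i.val < t ∧ g i = j then c i else 0

/-- `acc 0 = 0`. [folklore] -/
@[simp] theorem acc_zero : acc c g j 0 = 0 := by simp [acc]

/-- One more item. [folklore] -/
theorem acc_succ {t : ℕ} (ht : t < N) :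
    acc c g j (t + 1) = acc c g j t + if g ⟨t, ht⟩ = j then c ⟨t, ht⟩ else 0 := by
  unfold acc
  have key : (if g ⟨t, ht⟩ = j then c ⟨t, ht⟩ else 0) =
      ∑ i : Fin N, if i = ⟨t, ht⟩ then (if g i = j then c i else 0) else 0 := by
    rw [Finset.sum_ite_eq']
    simp
  rw [key, ← Finset.sum_add_distrib]
  refine Finset.sum_congr rfl fun i _ => ?_
  by_cases h2 : i = ⟨t, ht⟩
  · subst h2
    simp
  · have hne : i.val ≠ t := fun e => h2 (Fin.ext e)
    have hiff : (i.val < t + 1) ↔ (i.val < t) := by omega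
    simp only [hiff, h2, if_false, Nat.add_zero]

/-- All items: the weight of the fibre. [folklore] -/
theorem acc_of_le {t : ℕ} (ht : N ≤ t) : acc c g j t = ∑ i : Fin N, if g i = j then c i else 0 := by
  unfold acc
  refine Finset.sum_congr rfl fun i _ => ?_
  simp [show i.val < t from lt_of_lt_of_le i.isLt ht]

variable (A : List ℕ) (g : Fin A.length → Fin n)

/-- The `j`-th block after `t` moves: `a c^{s_j(t)} d^{m_j(t)}`. [cite: Heuer2020, Claim 4.3] -/
def blockZ (j : Fin n) (t : ℕ) : List (Fin 4) :=
  0 :: (List.replicate (acc (fun i => A[i.val]) g j t) 2 ++ List.replicate (acc (fun _ => 1) g j t) 3)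

/-- The word after `t` moves. [cite: Heuer2020, Claim 4.3] -/
def zWord (t : ℕ) : List (Fin 4) :=
  ((List.finRange n).map fun j => blockZ A g j t).flatten ++ [0] ++ List.replicate t 1 ++
    (A.drop t).flatMap itemW ++ [1]

/-- At the start: `z₀ = v`. [cite: Heuer2020, Claim 4.3] -/
theorem zWord_zero : zWord A g 0 = vWord A n := by
  have : ((List.finRange n).map fun j => blockZ A g j 0) = List.replicate n [0] := by
    rw [List.eq_replicate_iff]
    exact ⟨by simp, fun b hb => by obtain ⟨j, -, rfl⟩ := List.mem_map.1 hb; simp [blockZ]⟩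
  rw [zWord, this, vWord, List.replicate_succ']
  simp

/-- Splitting the block list at block `j₀`. [folklore] -/
theorem flatten_blocks_split (bl : Fin n → List (Fin 4)) (j₀ : Fin n) :
    ((List.finRange n).map bl).flatten =
      (((List.finRange n).map bl).take j₀.val).flatten ++ bl j₀ ++ (((List.finRange n).map bl).drop (j₀.val + 1)).flatten := by
  conv_lhs => rw [← List.take_append_drop j₀.val ((List.finRange n).map bl)]
  rw [List.flatten_append, List.drop_eq_getElem_cons (by simp), List.flatten_cons, List.append_assoc]
  simp

/-- Blocks other than `j₀` do not change in move `t`. [folklore] -/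
theorem blockZ_succ_of_ne {t : ℕ} (ht : t < A.length) {j : Fin n} (hj : g ⟨t, ht⟩ ≠ j) :
    blockZ A g j (t + 1) = blockZ A g j t := by
  simp [blockZ, acc_succ _ _ _ ht, hj]

/-- Block `j₀ = g(t)` absorbs `c^{a_t} d` in move `t`. [cite: Heuer2020, Claim 4.3] -/
theorem blockZ_succ_self {t : ℕ} (ht : t < A.length) :
    blockZ A g (g ⟨t, ht⟩) (t + 1) =
      0 :: (List.replicate (acc (fun i => A[i.val]) g (g ⟨t, ht⟩) t) 2 ++ (List.replicate A[t] 2 ++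
        3 :: List.replicate (acc (fun _ => 1) g (g ⟨t, ht⟩) t) 3)) := by
  simp only [blockZ, acc_succ _ _ _ ht, if_true, List.replicate_add, List.replicate_succ, List.append_assoc]

/-- The unchanged prefix of the block list. [folklore] -/
theorem take_blocks_succ {t : ℕ} (ht : t < A.length) :
    (((List.finRange n).map fun j => blockZ A g j (t + 1)).take (g ⟨t, ht⟩).val) =
      (((List.finRange n).map fun j => blockZ A g j t).take (g ⟨t, ht⟩).val) := by
  apply List.ext_getElem (by simp) fun i h₁ h₂ => ?_
  simp only [List.getElem_take, List.getElem_map, List.getElem_finRange]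
  apply blockZ_succ_of_ne _ _ ht
  intro e
  have := congrArg Fin.val e
  simp at this h₁
  omega

/-- The unchanged suffix of the block list. [folklore] -/
theorem drop_blocks_succ {t : ℕ} (ht : t < A.length) :
    (((List.finRange n).map fun j => blockZ A g j (t + 1)).drop ((g ⟨t, ht⟩).val + 1)) =
      (((List.finRange n).map fun j => blockZ A g j t).drop ((g ⟨t, ht⟩).val + 1)) := by
  apply List.ext_getElem (by simp) fun i h₁ h₂ => ?_
  simp only [List.getElem_drop, List.getElem_map, List.getElem_finRange]
  apply blockZ_succ_of_ne _ _ ht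
  intro e
  have := congrArg Fin.val e
  simp at this
  omega

/-- **One move is one cyclic block interchange**: `z_t → z_{t+1}` moves `c^{a_t} d` into block
`g(t)`. [cite: Heuer2020, Claim 4.3] -/
theorem isCBI_zWord_succ {t : ℕ} (ht : t < A.length) : IsCBI (zWord A g t) (zWord A g (t + 1)) := by
  set j₀ := g ⟨t, ht⟩ with hj₀
  set Pre := (((List.finRange n).map fun j => blockZ A g j t).take j₀.val).flatten with hPre
  set Post := (((List.finRange n).map fun j => blockZ A g j t).drop (j₀.val + 1)).flatten with hPost
  set rest := (A.drop (t + 1)).flatMap itemW with hrest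
  have hdrop : (A.drop t).flatMap itemW = itemW A[t] ++ rest := by
    rw [List.drop_eq_getElem_cons ht, List.flatMap_cons]
  have hz : zWord A g t = (Pre ++ 0 :: List.replicate (acc (fun i => A[i.val]) g j₀ t) 2) ++
      (List.replicate (acc (fun _ => 1) g j₀ t) 3 ++ Post ++ [0] ++ List.replicate t 1 ++ [1]) ++
      [] ++ (List.replicate A[t] 2 ++ [3]) ++ (rest ++ [1]) := by
    rw [zWord, flatten_blocks_split _ j₀, hdrop, itemW]
    simp [blockZ, hPre, hPost, List.append_assoc]
  have hz' : zWord A g (t + 1) = (Pre ++ 0 :: List.replicate (acc (fun i => A[i.val]) g j₀ t) 2) ++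
      (List.replicate A[t] 2 ++ [3]) ++ [] ++
      (List.replicate (acc (fun _ => 1) g j₀ t) 3 ++ Post ++ [0] ++ List.replicate t 1 ++ [1]) ++ (rest ++ [1]) := by
    rw [zWord, flatten_blocks_split _ j₀, take_blocks_succ A g ht, drop_blocks_succ A g ht, ← hPre, ← hPost, hj₀,
      blockZ_succ_self A g ht, ← hrest, List.replicate_succ']
    simp [List.append_assoc]
  exact IsCBI.of_linear _ _ _ _ _ hz hz'

/-- **Claim 4.3**: the moves form a sequence of `|A| − t` interchanges from `z_t` to `z_{|A|}`. [cite: Heuer2020, Claim 4.3] -/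
theorem reach_zWord : ∀ t, t ≤ A.length → Reach (A.length - t) (zWord A g t) (zWord A g A.length) := by
  intro t ht
  induction h : A.length - t generalizing t with
  | zero =>
    obtain rfl : t = A.length := by omega
    exact reach_zero.2 (List.IsRotated.refl _)
  | succ k ih =>
    exact ⟨_, isCBI_zWord_succ A g (by omega), ih (t + 1) (by omega) (by omega)⟩

/-- At the end: `z_{|A|} = w` when every fibre of `g` has four items summing to `B`. [cite: Heuer2020, Claim 4.3] -/
theorem zWord_length {B : ℕ} (hA : A.length = 4 * n) (hsum : ∀ j, (∑ i : Fin A.length, if g i = j then A[i.val] else 0) = B)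
    (hfib : ∀ j, (∑ i : Fin A.length, if g i = j then 1 else 0) = 4) : zWord A g A.length = wWord n B := by
  have hb : ∀ j, blockZ A g j A.length = groupW B := fun j => by
    rw [blockZ, acc_of_le _ _ _ le_rfl, acc_of_le _ _ _ le_rfl, hsum j, hfib j, groupW]
  have : ((List.finRange n).map fun j => blockZ A g j A.length) = List.replicate n (groupW B) := by
    rw [List.eq_replicate_iff]
    exact ⟨by simp, fun b hb' => by obtain ⟨j, -, rfl⟩ := List.mem_map.1 hb'; exact hb j⟩
  rw [zWord, this, wWord, List.drop_length, List.flatMap_nil, List.append_nil, hA, List.replicate_succ' (n := 4 * n)]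
  simp [List.append_assoc]

/-- **Claim 4.3**: a solution gives `d_cbi(v, w) ≤ 4n` (indeed a sequence of `|A| = 4n`
interchanges). [cite: Heuer2020, Claim 4.3] -/
theorem reach_of_solution {B : ℕ} (hA : A.length = 4 * n)
    (hsum : ∀ j, (∑ i : Fin A.length, if g i = j then A[i.val] else 0) = B)
    (hfib : ∀ j, (∑ i : Fin A.length, if g i = j then 1 else 0) = 4) : Reach A.length (vWord A n) (wWord n B) := by
  have h := reach_zWord A g 0 (Nat.zero_le _)
  rwa [Nat.sub_zero, zWord_zero, zWord_length A g hA hsum hfib] at h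

omit g in
/-- **Four to a group**: a fibre summing to `B` with all items in `(B/5, B/3)` has exactly four
items. [cite: GareyJohnson1979, §4.2 (4-PARTITION)] -/
theorem fibre_eq_four {ι : Type*} (F : Finset ι) (a : ι → ℕ) {B : ℕ} (hsum : ∑ i ∈ F, a i = B)
    (hlo : ∀ i ∈ F, B < 5 * a i) (hhi : ∀ i ∈ F, 3 * a i < B) (hB : 0 < B) : F.card = 4 := by
  have hne : F.Nonempty := by
    rw [Finset.nonempty_iff_ne_empty]; rintro rfl; simp at hsum; omega
  have h1 : F.card * B < 5 * B := by
    calc F.card * B = ∑ i ∈ F, B := by rw [Finset.sum_const, smul_eq_mul]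
      _ < ∑ i ∈ F, 5 * a i := Finset.sum_lt_sum_of_nonempty hne fun i hi => hlo i hi
      _ = 5 * B := by rw [← Finset.mul_sum, hsum]
  have h2 : 3 * B < F.card * B := by
    calc 3 * B = ∑ i ∈ F, 3 * a i := by rw [← Finset.mul_sum, hsum]
      _ < ∑ i ∈ F, B := Finset.sum_lt_sum_of_nonempty hne fun i hi => hhi i hi
      _ = F.card * B := by rw [Finset.sum_const, smul_eq_mul]
  have h1' : F.card < 5 := Nat.lt_of_mul_lt_mul_right h1
  have h2' : 3 < F.card := Nat.lt_of_mul_lt_mul_right h2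
  omega

end Construction

/-! ### Letters and counts of the two words -/

section Letters

variable (A : List ℕ) (n B : ℕ)

/-- `c`-count of an item word. [folklore] -/
theorem count_two_itemW (x : ℕ) : (itemW x).count 2 = x := by
  simp [itemW]

/-- `c`-count of the items part. [folklore] -/
theorem count_two_flatMap_itemW : (A.flatMap itemW).count 2 = A.sum := by
  induction A with
  | nil => simp
  | cons x A ih => rw [List.flatMap_cons, List.count_append, count_two_itemW, ih, List.sum_cons]

/-- **`c`-count of `v`: `Σ aᵢ`.** [folklore] -/
theorem count_two_vWord : (vWord A n).count 2 = A.sum := by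
  simp [vWord, List.count_replicate, count_two_flatMap_itemW]

/-- `c`-count of a group word. [folklore] -/
theorem count_two_groupW : (groupW B).count 2 = B := by
  simp [groupW]

/-- **`c`-count of `w`: `n B`.** [folklore] -/
theorem count_two_wWord : (wWord n B).count 2 = n * B := by
  simp only [wWord, List.count_append, List.count_flatten, List.map_replicate, count_two_groupW, List.sum_replicate,
    smul_eq_mul, List.count_singleton, List.count_replicate]
  simp

/-- Relatedness of `v` and `w` forces `Σ aᵢ = n B`. [cite: Heuer2020, §4.1] -/
theorem sum_eq_of_perm (h : List.Perm (vWord A n) (wWord n B)) : A.sum = n * B := by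
  rw [← count_two_vWord A n, ← count_two_wWord n B]
  exact h.count_eq 2

/-- Length of the items part of the first `i` items. [folklore] -/
def offI (i : ℕ) : ℕ := ((A.take i).flatMap itemW).length

/-- Start of the `c`-run of item `i` in `v`. [folklore] -/
def runStart (i : ℕ) : ℕ := (n + 1) + offI A i + 1

/-- The items part splits at item `i`. [folklore] -/
theorem flatMap_itemW_split {i : ℕ} (hi : i < A.length) :
    A.flatMap itemW = (A.take i).flatMap itemW ++ (itemW A[i] ++ (A.drop (i + 1)).flatMap itemW) := by
  conv_lhs => rw [← List.take_append_drop i A, List.flatMap_append, List.drop_eq_getElem_cons hi, List.flatMap_cons]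

/-- Length of `v`. [folklore] -/
theorem length_vWord : (vWord A n).length = (n + 1) + (A.flatMap itemW).length + 1 := by
  simp only [vWord, List.length_append, List.length_replicate, List.length_singleton]

/-- The run of item `i` fits inside `v`. [folklore] -/
theorem runStart_add_lt {i : ℕ} (hi : i < A.length) : runStart A n i + A[i] + 1 < (vWord A n).length := by
  rw [length_vWord, runStart, offI, flatMap_itemW_split A hi]
  simp only [List.length_append, length_itemW]
  omega

/-- `offI` steps by the item length. [folklore] -/
theorem offI_succ {i : ℕ} (hi : i < A.length) : offI A (i + 1) = offI A i + (A[i] + 2) := by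
  rw [offI, offI, List.take_succ_eq_append_getElem hi, List.flatMap_append]
  simp only [List.length_append, List.flatMap_cons, List.flatMap_nil, List.append_nil, length_itemW]

/-- `offI` is monotone. [folklore] -/
theorem offI_mono {i i' : ℕ} (h : i ≤ i') (hi' : i' ≤ A.length) : offI A i ≤ offI A i' := by
  induction i' with
  | zero => obtain rfl : i = 0 := Nat.le_zero.1 h; exact le_rfl
  | succ i' ih =>
    rcases Nat.lt_or_ge i (i' + 1) with hlt | hge
    · exact (ih (Nat.lt_succ_iff.1 hlt) (Nat.le_of_succ_le hi')).trans (by rw [offI_succ A hi']; omega)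
    · rw [le_antisymm h hge]

/-- **The `c`-run of item `i` in `v`**: letters `2` at `runStart i + o`, `o < aᵢ`. [folklore] -/
theorem vWord_getElem_run {i : ℕ} (hi : i < A.length) {o : ℕ} (ho : o < A[i]) :
    (vWord A n)[runStart A n i + o]'(by have := runStart_add_lt A n hi; omega) = 2 := by
  have hsplit : vWord A n = (List.replicate (n + 1) 0 ++ (A.take i).flatMap itemW ++ [1]) ++
      (List.replicate A[i] 2 ++ ([3] ++ (A.drop (i + 1)).flatMap itemW ++ [1])) := by
    rw [vWord, flatMap_itemW_split A hi, itemW]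
    simp [List.append_assoc]
  have hlen : (List.replicate (n + 1) 0 ++ (A.take i).flatMap itemW ++ [1]).length = runStart A n i := by
    simp only [List.length_append, List.length_replicate, List.length_singleton, runStart, offI]
  rw [List.getElem_of_eq hsplit, List.getElem_append_right (by rw [hlen]; omega)]
  simp only [hlen, Nat.add_sub_cancel_left]
  rw [List.getElem_append_left (by simpa using ho)]
  simp

/-- Distinct run positions of `v` are distinct. [folklore] -/
theorem runStart_disjoint {i o i' o' : ℕ} (hi : i < A.length) (ho : o < A[i]) (hi' : i' < A.length) (ho' : o' < A[i'])
    (h : runStart A n i + o = runStart A n i' + o') : i = i' ∧ o = o' := by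
  rcases lt_trichotomy i i' with hlt | rfl | hgt
  · exfalso
    have h1 := offI_succ A hi
    have h2 := offI_mono A (show i + 1 ≤ i' by omega) hi'.le
    simp only [runStart] at h
    omega
  · simp only [runStart] at h
    exact ⟨rfl, by omega⟩
  · exfalso
    have h1 := offI_succ A hi'
    have h2 := offI_mono A (show i' + 1 ≤ i by omega) hi.le
    simp only [runStart] at h
    omega

/-- Length of `w`. [folklore] -/
theorem length_wWord : (wWord n B).length = n * (B + 5) + 1 + (4 * n + 1) := by
  simp only [wWord, List.length_append, List.length_flatten, List.map_replicate, List.sum_replicate, smul_eq_mul,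
    length_groupW, List.length_singleton, List.length_replicate]

/-- Letters of `K` copies of a block. [folklore] -/
theorem getElem_flatten_replicate {α : Type*} (K : ℕ) (cd : List α) {m o : ℕ} (hm : m < K) (ho : o < cd.length)
    (h : m * cd.length + o < (List.replicate K cd).flatten.length) :
    (List.replicate K cd).flatten[m * cd.length + o] = cd[o] := by
  induction K generalizing m with
  | zero => omega
  | succ K ih =>
    simp only [List.replicate_succ, List.flatten_cons]
    rcases Nat.eq_zero_or_pos m with rfl | hm0
    · rw [List.getElem_append_left (by simpa using ho)]
      simp
    · have e : m * cd.length + o = cd.length + ((m - 1) * cd.length + o) := by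
        rw [Nat.sub_one_mul]
        have := Nat.le_mul_of_pos_left cd.length hm0
        omega
      simp only [e]
      rw [List.getElem_append_right (by omega)]
      simp only [Nat.add_sub_cancel_left]
      exact ih (by omega) _

/-- Letters of the groups part of `w`. [folklore] -/
theorem getElem_groups {m o : ℕ} (hm : m < n) (ho : o < B + 5)
    (h : m * (B + 5) + o < (List.replicate n (groupW B)).flatten.length) :
    ((List.replicate n (groupW B)).flatten)[m * (B + 5) + o] = (groupW B)[o]'(by rw [length_groupW]; exact ho) := by
  have e : m * (B + 5) + o = m * (groupW B).length + o := by rw [length_groupW]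
  simp only [e]
  exact getElem_flatten_replicate n (groupW B) hm (by rw [length_groupW]; exact ho) _

/-- Letters of a group word: `c` exactly at offsets `1 … B`. [folklore] -/
theorem groupW_getElem_eq_two_iff {q : ℕ} (hq : q < B + 5) :
    (groupW B)[q]'(by rw [length_groupW]; exact hq) = 2 ↔ 1 ≤ q ∧ q ≤ B := by
  rcases Nat.eq_zero_or_pos q with rfl | hq0
  · simp [groupW]
  · have : (groupW B)[q]'(by rw [length_groupW]; exact hq) =
        (List.replicate B (2 : Fin 4) ++ List.replicate 4 3)[q - 1]'(by simp; omega) := by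
      simp only [groupW]
      rw [List.getElem_cons, dif_neg (by omega)]
    rw [this]
    by_cases hB : q - 1 < B
    · rw [List.getElem_append_left (by simpa using hB), List.getElem_replicate]
      simp only [true_iff]; omega
    · rw [List.getElem_append_right (by simpa using hB), List.getElem_replicate]
      simp only [Fin.isValue, Fin.reduceEq, false_iff, not_and, not_le]; omega

/-- The length of the groups part of `w`. [folklore] -/
theorem length_groups : ((List.replicate n (groupW B)).flatten).length = n * (B + 5) := by
  simp [List.length_flatten, List.map_replicate, List.sum_replicate]

/-- **Letters of `w`: `c` exactly inside the groups at offsets `1 … B`.** [folklore] -/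
theorem wWord_getElem_eq_two_iff {p : ℕ} (hp : p < (wWord n B).length) :
    (wWord n B)[p] = 2 ↔ p < n * (B + 5) ∧ 1 ≤ p % (B + 5) ∧ p % (B + 5) ≤ B := by
  have hG := length_groups n B
  have hsplit : wWord n B = (List.replicate n (groupW B)).flatten ++ ([0] ++ List.replicate (4 * n + 1) 1) := by
    simp [wWord]
  rw [List.getElem_of_eq hsplit]
  by_cases h1 : p < n * (B + 5)
  · rw [List.getElem_append_left (by rw [hG]; exact h1)]
    obtain ⟨m, o, ho, rfl⟩ : ∃ m o, o < B + 5 ∧ p = m * (B + 5) + o :=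
      ⟨p / (B + 5), p % (B + 5), Nat.mod_lt _ (by omega), (Nat.div_add_mod' _ _).symm⟩
    have hm : m < n := by
      by_contra hmn
      push Not at hmn
      have : n * (B + 5) ≤ m * (B + 5) := Nat.mul_le_mul_right _ hmn
      omega
    have e1 : (m * (B + 5) + o) % (B + 5) = o := by
      rw [Nat.add_comm, Nat.add_mul_mod_self_right, Nat.mod_eq_of_lt ho]
    rw [getElem_groups n B hm ho, groupW_getElem_eq_two_iff B ho, e1]
    simp [h1]
  · simp only [h1, false_and, iff_false]
    rw [List.getElem_append_right (by rw [hG]; omega)]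
    have hl := length_wWord n B
    have hmem := List.getElem_mem (l := [0] ++ List.replicate (4 * n + 1) (1 : Fin 4))
      (n := p - (List.replicate n (groupW B)).flatten.length)
      (by simp only [List.length_append, List.length_singleton, List.length_replicate, hG]; omega)
    intro h2
    rw [h2] at hmem
    simp [List.mem_replicate] at hmem

/-- **The position after a `c` of `w` is in the same group** (a `c` sits at offset `≤ B < B + 4`
of its group; in particular a run of `c`'s never wraps around). [folklore] -/
theorem wWord_succ_of_two {p : ℕ} (hp : p < (wWord n B).length) (h2 : (wWord n B)[p] = 2) :
    p + 1 < (wWord n B).length ∧ (p + 1) / (B + 5) = p / (B + 5) := by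
  rw [wWord_getElem_eq_two_iff] at h2
  have hlen := length_wWord n B
  have hp1 : p + 1 < (wWord n B).length := by omega
  refine ⟨hp1, ?_⟩
  -- `p % (B+5) < B+4`, so adding one does not cross a group boundary
  have hr := Nat.div_add_mod' p (B + 5)
  exact Nat.div_eq_of_lt_le (by omega) (by rw [Nat.succ_mul]; omega)

end Letters

/-! ### Claims 4.2/4.4: `4n` interchanges give a solution -/

/-- **Claim 4.4 (with 4.2)**: if `v ~ w` and `d_cbi(v, w) ≤ 4n` for a valid instance, then the
instance is solvable — an optimal sequence lowers `ν` by `6` at every step, so (Lemma 4.5 (iii)) no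
step cuts a `cc`; the runs `c^{aᵢ}` therefore travel intact (`CBI.exists_track_runs`) into the runs
`c^B` of `w`, and counting the `c`'s of each run of `w` shows that the induced assignment has all
sums equal to `B`. [cite: Heuer2020, Thm. 4.1, Claims 4.2 and 4.4] -/
theorem solution_of_reach (A : List ℕ) (n B : ℕ) (hA : A.length = 4 * n) (hlo : ∀ x ∈ A, B < 5 * x)
    (hhi : ∀ x ∈ A, 3 * x < B) (hperm : List.Perm (vWord A n) (wWord n B))
    (hd : dcbi (vWord A n) (wWord n B) ≤ 4 * n) :
    ∃ g : Fin A.length → Fin n, ∀ j, (∑ i : Fin A.length, if g i = j then A[i.val] else 0) = B := by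
  classical
  rcases Nat.eq_zero_or_pos n with rfl | hn
  · obtain rfl : A = [] := List.length_eq_zero_iff.1 (by simpa using hA)
    exact ⟨fun i => i.elim0, fun j => j.elim0⟩
  have h1 : ∀ x ∈ A, 1 ≤ x := fun x hx => by have := hlo x hx; omega
  have h1' : ∀ i : Fin A.length, 1 ≤ A[i.val] := fun i => h1 _ (List.getElem_mem _)
  have hsum : A.sum = n * B := sum_eq_of_perm A n B hperm
  -- an optimal sequence has `4n` steps, lowering `ν` by `6 · 4n` in total
  have hν := nuL_vWord_sub_nuL_wWord A n B hA h1 hhi hsum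
  have hreach : Reach (4 * n) (vWord A n) (wWord n B) := (reach_dcbi hperm).mono hd
  have hν' : nuL (vWord A n) - nuL (wWord n B) = 6 * (4 * n : ℕ) := by rw [hν]; push_cast; ring
  -- the runs of `c` in `v`
  set N := (vWord A n).length with hN
  let U₀ : Fin N → Fin 4 := fun x => (vWord A n)[x.val]
  have hU₀ : List.ofFn U₀ = vWord A n := List.ofFn_getElem
  let start : Fin A.length → Fin N := fun i => ⟨runStart A n i.val, by have := runStart_add_lt A n i.isLt; omega⟩
  let len : Fin A.length → ℕ := fun i => A[i.val]
  have hpow : ∀ (i : Fin A.length) (o : ℕ), o < len i → ((finRotate N ^ o) (start i)).val = runStart A n i.val + o := by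
    intro i o ho
    rw [Bardakov.val_finRotate_pow, Nat.mod_eq_of_lt]
    have := runStart_add_lt A n i.isLt
    simp only [len] at ho
    show runStart A n i.val + o < N
    omega
  have hc : ∀ i ∈ (Finset.univ : Finset (Fin A.length)), ∀ o, o < len i → U₀ ((finRotate N ^ o) (start i)) = 2 := by
    intro i _ o ho
    have e := hpow i o ho
    simp only [U₀, e]
    exact vWord_getElem_run A n i.isLt ho
  rw [← hU₀] at hreach hν'
  obtain ⟨Φ, U, hrot, hU, hrig⟩ := exists_track_runs start len Finset.univ (4 * n) U₀ (wWord n B) hreach hν' hc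
  -- absorb the final rotation
  obtain ⟨W', k, hW', hUW⟩ := exists_comp_pow_of_isRotated (V := U) (v' := wWord n B) hrot.symm
  set Ψ := finRotate N ^ k * Φ with hΨ
  have hNw : (wWord n B).length = N := by rw [hW', List.length_ofFn]
  have hW : ∀ x, W' (Ψ x) = U₀ x := fun x => by
    rw [hΨ, Perm.mul_apply, ← Function.comp_apply (f := W'), ← hUW, hU]
  have hW'get : ∀ y : Fin N, W' y = (wWord n B)[y.val]'(by rw [hNw]; exact y.isLt) := fun y => by
    rw [List.getElem_of_eq hW', List.getElem_ofFn]
  have hcomm : ∀ (o : ℕ) (y : Fin N), (finRotate N ^ k) ((finRotate N ^ o) y) = (finRotate N ^ o) ((finRotate N ^ k) y) := by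
    intro o y
    rw [← Perm.mul_apply, ← Perm.mul_apply, (Commute.pow_pow_self (finRotate N) k o).eq]
  have hrigΨ : ∀ (i : Fin A.length) (o : ℕ), o < len i → Ψ ((finRotate N ^ o) (start i)) = (finRotate N ^ o) (Ψ (start i)) := by
    intro i o ho
    rw [hΨ, Perm.mul_apply, Perm.mul_apply, hrig i (Finset.mem_univ _) o ho, hcomm]
  have hletter : ∀ (i : Fin A.length) (o : ℕ), o < len i →
      (wWord n B)[((finRotate N ^ o) (Ψ (start i))).val]'(by rw [hNw]; exact Fin.isLt _) = 2 := by
    intro i o ho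
    rw [← hW'get, ← hrigΨ i o ho, hW]
    exact hc i (Finset.mem_univ _) o ho
  -- each run lands linearly inside one group of `w`
  have hland : ∀ (i : Fin A.length) (o : ℕ), o < len i →
      ((finRotate N ^ o) (Ψ (start i))).val = (Ψ (start i)).val + o ∧
        ((Ψ (start i)).val + o) / (B + 5) = (Ψ (start i)).val / (B + 5) := by
    intro i o ho
    induction o with
    | zero => simp
    | succ o ih =>
      obtain ⟨hv, hq⟩ := ih (Nat.lt_of_succ_lt ho)
      have h2 := hletter i o (Nat.lt_of_succ_lt ho)
      obtain ⟨hlt, hq'⟩ := wWord_succ_of_two n B _ h2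
      rw [hv] at hlt hq'
      rw [hNw] at hlt
      refine ⟨?_, by rw [← add_assoc, hq', hq]⟩
      rw [pow_succ', Perm.mul_apply, val_finRotate_eq_mod, hv, Nat.mod_eq_of_lt hlt, add_assoc]
  -- the assignment: the group in which the run of item `i` lands
  have hstart2 : ∀ i : Fin A.length, (wWord n B)[(Ψ (start i)).val]'(by rw [hNw]; exact Fin.isLt _) = 2 := by
    intro i
    have := hletter i 0 (h1' i)
    simpa using this
  have hgq : ∀ i : Fin A.length, (Ψ (start i)).val / (B + 5) < n := by
    intro i
    have h2 := hstart2 i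
    rw [wWord_getElem_eq_two_iff] at h2
    exact (Nat.div_lt_iff_lt_mul (by omega)).2 h2.1
  let g : Fin A.length → Fin n := fun i => ⟨(Ψ (start i)).val / (B + 5), hgq i⟩
  refine ⟨g, ?_⟩
  -- counting: the `c`'s of the runs assigned to group `j` are distinct `c`'s of that group
  have hle : ∀ j : Fin n, (∑ i : Fin A.length, if g i = j then A[i.val] else 0) ≤ B := by
    intro j
    let T : Finset (Σ _ : Fin A.length, ℕ) := (Finset.univ.filter fun i => g i = j).sigma fun i => Finset.range A[i.val]
    have hT : T.card = ∑ i : Fin A.length, if g i = j then A[i.val] else 0 := by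
      rw [Finset.card_sigma, Finset.sum_filter]
      simp
    rw [← hT]
    have key : T.card ≤ (Finset.Ico (j.val * (B + 5) + 1) (j.val * (B + 5) + 1 + B)).card := by
      refine Finset.card_le_card_of_injOn (fun io => (Ψ (start io.1)).val + io.2) (fun io hio => ?_) ?_
      · rw [Finset.mem_coe] at hio
        obtain ⟨hi, ho⟩ : g io.1 = j ∧ io.2 < A[io.1.val] := by simpa [T] using hio
        obtain ⟨hval, hquot⟩ := hland io.1 io.2 ho
        have h2 := hletter io.1 io.2 ho
        simp only [hval] at h2
        rw [wWord_getElem_eq_two_iff] at h2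
        have hj : ((Ψ (start io.1)).val + io.2) / (B + 5) = j.val := by
          rw [hquot]; exact congrArg Fin.val hi
        have hdm := Nat.div_add_mod' ((Ψ (start io.1)).val + io.2) (B + 5)
        rw [hj] at hdm
        simp only [Finset.mem_coe, Finset.mem_Ico]
        omega
      · intro io hio io' hio' heq
        rw [Finset.mem_coe] at hio hio'
        obtain ⟨-, ho⟩ : g io.1 = j ∧ io.2 < A[io.1.val] := by simpa [T] using hio
        obtain ⟨-, ho'⟩ : g io'.1 = j ∧ io'.2 < A[io'.1.val] := by simpa [T] using hio'
        simp only at heq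
        -- equal landing positions come from equal starting positions
        have e1 := (hland io.1 io.2 ho).1
        have e2 := (hland io'.1 io'.2 ho').1
        have hfin : (finRotate N ^ io.2) (Ψ (start io.1)) = (finRotate N ^ io'.2) (Ψ (start io'.1)) :=
          Fin.ext (by rw [e1, e2, heq])
        rw [← hrigΨ io.1 io.2 ho, ← hrigΨ io'.1 io'.2 ho'] at hfin
        have hfin' := congrArg Fin.val (Ψ.injective hfin)
        rw [hpow io.1 io.2 ho, hpow io'.1 io'.2 ho'] at hfin'
        obtain ⟨hi, hoo⟩ := runStart_disjoint A n io.1.isLt ho io'.1.isLt ho' hfin'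
        exact Sigma.ext (Fin.ext hi) (heq_of_eq hoo)
    simpa using key
  -- the fibres sum to `Σ aᵢ = n B` in total, so each is exactly `B`
  have htot : ∑ j : Fin n, (∑ i : Fin A.length, if g i = j then A[i.val] else 0) = n * B := by
    rw [Finset.sum_comm]
    simp only [Finset.sum_ite_eq, Finset.mem_univ, if_true]
    rw [Fin.sum_univ_getElem, hsum]
  intro j
  by_contra hne
  have hlt : ∑ j : Fin n, (∑ i : Fin A.length, if g i = j then A[i.val] else 0) < ∑ _j : Fin n, B :=
    Finset.sum_lt_sum (fun j _ => hle j) ⟨j, Finset.mem_univ _, lt_of_le_of_ne (hle j) hne⟩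
  rw [htot, Finset.sum_const, Finset.card_univ, Fintype.card_fin, smul_eq_mul] at hlt
  exact lt_irrefl _ hlt

/-- **Theorem 4.1** (`m = 4`): a valid instance (`|A| = 4n`, `B/5 < aᵢ < B/3`) is solvable iff
`v ~ w` and `d_cbi(v, w) ≤ 4n`. [cite: Heuer2020, Thm. 4.1] -/
theorem solvable_iff (A : List ℕ) (n B : ℕ) (hA : A.length = 4 * n) (hlo : ∀ x ∈ A, B < 5 * x)
    (hhi : ∀ x ∈ A, 3 * x < B) :
    (∃ g : Fin A.length → Fin n, ∀ j, (∑ i : Fin A.length, if g i = j then A[i.val] else 0) = B) ↔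
      (List.Perm (vWord A n) (wWord n B) ∧ dcbi (vWord A n) (wWord n B) ≤ 4 * n) := by
  classical
  constructor
  · rintro ⟨g, hg⟩
    have hfib : ∀ j, (∑ i : Fin A.length, if g i = j then 1 else 0) = 4 := by
      intro j
      rcases Nat.eq_zero_or_pos B with hB | hB
      · -- `B = 0`: no item can exist, so `n = 0`
        exfalso
        rcases A with _ | ⟨x, A'⟩
        · simp only [List.length_nil] at hA
          have : n = 0 := by omega
          subst this
          exact j.elim0
        · have := hhi x (by simp); omega
      have := fibre_eq_four (Finset.univ.filter fun i : Fin A.length => g i = j) (fun i => A[i.val]) (B := B)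
        (by rw [Finset.sum_filter]; exact hg j) (fun i _ => hlo _ (List.getElem_mem _)) (fun i _ => hhi _ (List.getElem_mem _)) hB
      rw [← this, Finset.card_eq_sum_ones, Finset.sum_filter]
    have hreach := reach_of_solution A g hA hg hfib
    rw [hA] at hreach
    exact ⟨hreach.perm, dcbi_le_of_reach hreach⟩
  · rintro ⟨hperm, hd⟩
    exact solution_of_reach A n B hA hlo hhi hperm hd

end FPG

end Literature.GroupTheory.CombinatorialGroupTheory
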